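import Literature.MathematicalPhysics.QuantumFieldTheory.Balaban1983to89.B9Eq326OperatorTower

/-!
# T. Bałaban, *Propagators for lattice gauge theories in a background field*, Commun. Math. Phys. **99** (1985) 389–434 [Balaban1985BackgroundPropagators]
# (3.15)–(3.16) p. 393, (3.26) p. 395, (3.126) p. 420, with [Balaban1985Averaging] (122) p. 36 and [Balaban1985Variational] (45) p. 285, (103) p. 293, (110) p. 294:
# **THE OPERATORS `Q_k(U)`, `Δ_{a,k}(U)`, `G₁,k(U)`, `H₁,k(U)` OF NE9's TOWER DO NOT DEPEND ON THE REGULARITY DISPLAY OF THE LEVEL AVERAGES NOR ON THE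
# POSITIVITY WITNESS** — bookkeeping for the `∃ αU … hpos` packaging of row (D4)'s END on print's class («Y12a»∕«Y12b»)

CITATION HEADER (lean-in-tree rule 2026-08-18).  Sources: [Balaban1985BackgroundPropagators] (held `paper:balaban1985-cmp99-background-propagators`, journal page
= PDF page + 388): (3.15)–(3.16) p. 393 (the composite averaging `Q_k(U) = Q(Ū^{k−1})⋯Q(U)`), (3.26) p. 395 (`Δ_a = Δ(U) + DR(U)D* + Q*aQ`), (3.126) p. 420
(`H₁ = G₁Q*(QG₁Q*)⁻¹`); [Balaban1985Averaging] (`paper:balaban1985-cmp98-averaging`, journal page = PDF page + 16) (122) p. 36 (the formula of `Q(V₀)A`);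
[Balaban1985Variational] (45) p. 285, (103) p. 293, (110) p. 294.  Read in the headers and bodies of the tree files `B9Eq315QTorus`, `B9Eq315QTower`,
`B9Eq326OperatorTower`, `B11Eq103H1Complex` this generation; nothing of print is asserted here.

WHY THIS FILE (audit cell `pub-balaban`, BINDER row (D4), OWNER lineage `b2b-balaban-beta-an4`, gen 112; «Y12c»).  The NE9 cell's tower operators
`B9Eq326OperatorTower.QkW ∕ laplaceAk ∕ G1k ∕ H1k` take as ARGUMENTS a regularity display `αU` of the level averages `Ū^j` with its proofs (`hα1`, `hU1`,
`hreg`), the onto-threshold `hαL` and a positivity witness `hpos` ([5] Thm 3.11).  Print's `Q(V₀)A` ([4] (122)) is a formula in `V₀` and `A` alone — the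
display only certifies that the block holonomies lie in the domain where [4] Prop. 1's logarithm is the analytic one (`B9Eq315QTorus.QtorusAt_apply` is
`rfl` on a display-free right-hand side) — and `G₁ = Δ_a⁻¹`, `(QG₁Q*)⁻¹`, `H₁` are determined by the operators (the witnesses are `Prop`s).  Row (D4)'s END
on print's class («Y12a» `Beta.RemainderHasMajH1kTowerPlaquette`, «Y12b» `Beta.RemainderOriginTowerPlaquette`) DERIVES a display and a witness and concludes
`∃ αU hα1 hαL hU1 hreg hpos, … (H1k … αU hα1 hU1 hreg … hαL hpos) …`; THIS FILE records, as kernel theorems, that a consumer holding ANY OTHER admissible display ∕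
witness reads the SAME maps:
* `Qtower_display_irrel` — `B9Eq315QTower.Qtower` at two displays `(α, hα1, hU1, hreg)`, `(α′, hα1′, hU1′, hreg′)` of the same level backgrounds agree
  (induction on the number of levels; `Qtower_succ`, then `congr` through `B9Eq315QTorus.QtorusLin`'s display-free body); `QkOfU_display_irrel`; **`QkW_display_irrel`**; **`laplaceAk_display_irrel`**;
* `G1LatticeK_congr`, `KinvLatticeK_congr`, `H1LatticeK_congr` — `B11Eq103H1Complex`'s lattice Green's functions at equal averaging operators and any two
  positivity ∕ onto witnesses agree (`subst`; proof-irrelevance);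
* **`G1k_display_irrel`**, **`KinvLatticeK_display_irrel`**, **`H1k_display_irrel`** — the tower's `G₁,k(U)`, `(Q_kG₁,kQ_k†)⁻¹`, `H₁,k(U)` at two displays, two
  onto-thresholds and two positivity witnesses agree.

HONEST SCOPE.  [folklore] definitional bookkeeping (an induction, three `subst … ; rfl`, four `unfold … ; rw`); no estimate of [5] or [4] is touched;
nothing of Bałaban's step-`k` objects identified (NODE O FROZEN (0)).  Row (D4) class UNCHANGED (instance 0∕1; D4 DISCHARGE NO DATE); NOT B12 Thm 2, NOT
BetaPertH, NOT continuum, NOT Clay.  HONEST DEPENDENCY (cell line): continuum YM on T⁴ ⇐ BetaPertH ∧ nine spine estimates (0/9 proved); BetaPertH ⇐ (D1) ∧ (D4) ∧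
CAP+tail; G-an2-4 gates asym, D1 and NE2/3/4.  NEW file importing `B9Eq326OperatorTower` only (BUILT); nothing modified; 0 `def`; standard axioms; no `sorry`.
Net new unproved facts: 0.
-/

noncomputable section

open scoped InnerProductSpace ComplexConjugate

namespace Literature.MathematicalPhysics.QuantumFieldTheory.Balaban1983to89.Beta.RemainderTowerDisplayIrrel

open B4Sect5Torus (TSite)
open B9SectCLatticeCarrier (Bond)
open B7Prop1Explicit (U1 Wcx boxVec)
open B9Eq319QprimeTorus (fineP)
open B9Eq315QTorus (perCfg cornerSite)
open B9Eq315QTower (towerP UlevOf Qtower Qtower_succ QkOfU)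
open B11Eq103H1Complex (SiteL2K BondL2K laplaceALatticeK G1LatticeK KinvLatticeK H1LatticeK)
open B9Eq326OperatorTower (QkW laplaceAk G1k H1k)

/-! ## §1 The composite averaging at two regularity displays -/

section Composite

variable {d : ℕ} {𝔸 : Type*} [NormedRing 𝔸] [NormedAlgebra ℂ 𝔸] [CompleteSpace 𝔸] [NormOneClass 𝔸]
  (L : ℕ) [NeZero L] (m : Fin d → ℕ) [∀ i, NeZero (m i)] (hL : 1 ≤ L)
  (Ulev : (n : ℕ) → Bond d (towerP L m (n + 1)) → 𝔸ˣ) (α α' : ℕ → ℝ) (hα1 : ∀ n, α n ≤ 1 / 64) (hα1' : ∀ n, α' n ≤ 1 / 64)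
  (hU1 hU1' : ∀ (n : ℕ) (x : B7Prop1Explicit.Site d) (κ : Fin d), perCfg (towerP L m (n + 1)) (Ulev n) x κ ∈ U1 𝔸)
  (hreg : ∀ (n : ℕ) (y : TSite d (towerP L m n)) (κ : Fin d) (r : Fin d → Fin L),
    ‖((Wcx L (perCfg (towerP L m (n + 1)) (Ulev n)) (cornerSite L y) κ (boxVec L r) : 𝔸ˣ) : 𝔸) - 1‖ ≤ α n)
  (hreg' : ∀ (n : ℕ) (y : TSite d (towerP L m n)) (κ : Fin d) (r : Fin d → Fin L),
    ‖((Wcx L (perCfg (towerP L m (n + 1)) (Ulev n)) (cornerSite L y) κ (boxVec L r) : 𝔸ˣ) : 𝔸) - 1‖ ≤ α' n)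

/-- **THE COMPOSITE AVERAGING (3.15) DOES NOT DEPEND ON THE REGULARITY DISPLAY**: `Qtower` at two displays `(α, hα1, hU1, hreg)`, `(α′, hα1′, hU1′, hreg′)`
of the same level backgrounds is the same linear map at every number of levels ([4] (122): `(Q(V₀)A)(y,κ) = L⁻¹·L(Q(Ṽ₀)Ã)_c` — display-free;
`B9Eq315QTorus.QtorusLin_apply`). [cite: Balaban1985BackgroundPropagators, (3.15) p.393; Balaban1985Averaging, (122) p.36] -/
theorem Qtower_display_irrel (k : ℕ) : Qtower L m hL Ulev α hα1 hU1 hreg k = Qtower L m hL Ulev α' hα1' hU1' hreg' k := by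
  induction k with
  | zero => rfl
  | succ k ih =>
    -- the two one-step factors unfold to the same display-free formula (`QtorusLin_apply`): `congr` closes the goal
    rw [Qtower_succ, Qtower_succ, ih]
    congr 1

end Composite

/-! ## §2 `B11Eq103H1Complex`'s lattice Green's functions at equal data and any witnesses -/

section Lattice

variable {𝕜 : Type*} [RCLike 𝕜] {d : ℕ} {Pd : Fin d → ℕ} {W : Type*} [NormedAddCommGroup W] [InnerProductSpace 𝕜 W] [FiniteDimensional 𝕜 W]
  {c₀ : ℝ} [Fact (0 < c₀)] {F : Type*} [NormedAddCommGroup F] [InnerProductSpace 𝕜 F] [FiniteDimensional 𝕜 F]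
  {c : 𝕜} {R S : Bond d Pd → W →ₗ[𝕜] W} {Δ₁ : BondL2K 𝕜 d Pd c₀ W →ₗ[𝕜] BondL2K 𝕜 d Pd c₀ W}
  {Rr : SiteL2K 𝕜 d Pd c₀ W →ₗ[𝕜] SiteL2K 𝕜 d Pd c₀ W} {Q Q' : BondL2K 𝕜 d Pd c₀ W →ₗ[𝕜] F} {a : ℝ}

/-- `G₁` on the lattice at equal averaging operators and two positivity witnesses is the same map (the witness is a `Prop`).
[cite: Balaban1985Variational, (110) p.294] -/
theorem G1LatticeK_congr (h : Q = Q')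
    (hpos : ∀ x : BondL2K 𝕜 d Pd c₀ W, x ≠ 0 → 0 < RCLike.re ⟪x, laplaceALatticeK c R S Δ₁ Rr Q a x⟫_𝕜)
    (hpos' : ∀ x : BondL2K 𝕜 d Pd c₀ W, x ≠ 0 → 0 < RCLike.re ⟪x, laplaceALatticeK c R S Δ₁ Rr Q' a x⟫_𝕜) :
    G1LatticeK hpos = G1LatticeK hpos' := by
  subst h; rfl

/-- `(QG₁Q*)⁻¹` on the lattice at equal averaging operators and any positivity ∕ onto witnesses is the same map.
[cite: Balaban1985Variational, (45) p.285] -/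
theorem KinvLatticeK_congr (h : Q = Q')
    (hpos : ∀ x : BondL2K 𝕜 d Pd c₀ W, x ≠ 0 → 0 < RCLike.re ⟪x, laplaceALatticeK c R S Δ₁ Rr Q a x⟫_𝕜)
    (hpos' : ∀ x : BondL2K 𝕜 d Pd c₀ W, x ≠ 0 → 0 < RCLike.re ⟪x, laplaceALatticeK c R S Δ₁ Rr Q' a x⟫_𝕜)
    (hQ : Function.Surjective Q) (hQ' : Function.Surjective Q') :
    KinvLatticeK hpos hQ = KinvLatticeK hpos' hQ' := by
  subst h; rfl

/-- `H₁ = G₁Q†(QG₁Q*)⁻¹` on the lattice at equal averaging operators and any positivity ∕ onto witnesses is the same map.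
[cite: Balaban1985Variational, (45) p.285, (103) p.293] -/
theorem H1LatticeK_congr (h : Q = Q')
    (hpos : ∀ x : BondL2K 𝕜 d Pd c₀ W, x ≠ 0 → 0 < RCLike.re ⟪x, laplaceALatticeK c R S Δ₁ Rr Q a x⟫_𝕜)
    (hpos' : ∀ x : BondL2K 𝕜 d Pd c₀ W, x ≠ 0 → 0 < RCLike.re ⟪x, laplaceALatticeK c R S Δ₁ Rr Q' a x⟫_𝕜)
    (hQ : Function.Surjective Q) (hQ' : Function.Surjective Q') :
    H1LatticeK hpos hQ = H1LatticeK hpos' hQ' := by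
  subst h; rfl

end Lattice

/-! ## §3 The tower's `Q_k(U)`, `Δ_{a,k}(U)`, `G₁,k(U)`, `(Q_kG₁,kQ_k†)⁻¹`, `H₁,k(U)` at two displays and two witnesses -/

section Tower

variable {d : ℕ} (L : ℕ) [NeZero L] (m : Fin d → ℕ) [∀ i, NeZero (m i)] (n : ℕ)
  {𝔸 : Type*} [NormedRing 𝔸] [NormedAlgebra ℂ 𝔸] [CompleteSpace 𝔸] [NormOneClass 𝔸]
  {W : Type*} [NormedAddCommGroup W] [InnerProductSpace ℂ W] (φ : W ≃ₗ[ℂ] 𝔸) {c₀ c₁ : ℝ} (η : ℝ)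
  (U : Bond d (towerP L m (n + 1)) → 𝔸ˣ) (hL : 1 ≤ L) (αU αU' : ℕ → ℝ) (hα1 : ∀ j, αU j ≤ 1 / 64) (hα1' : ∀ j, αU' j ≤ 1 / 64)
  (hU1 hU1' : ∀ (j : ℕ) (x : B7Prop1Explicit.Site d) (κ : Fin d), perCfg (towerP L m (j + 1)) (UlevOf L m (n + 1) U j) x κ ∈ U1 𝔸)
  (hreg : ∀ (j : ℕ) (y : TSite d (towerP L m j)) (κ : Fin d) (r : Fin d → Fin L),
    ‖((Wcx L (perCfg (towerP L m (j + 1)) (UlevOf L m (n + 1) U j)) (cornerSite L y) κ (boxVec L r) : 𝔸ˣ) : 𝔸) - 1‖ ≤ αU j)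
  (hreg' : ∀ (j : ℕ) (y : TSite d (towerP L m j)) (κ : Fin d) (r : Fin d → Fin L),
    ‖((Wcx L (perCfg (towerP L m (j + 1)) (UlevOf L m (n + 1) U j)) (cornerSite L y) κ (boxVec L r) : 𝔸ˣ) : 𝔸) - 1‖ ≤ αU' j)

/-- `Q_{n+1}(U)` of (3.15) on the bond functions at two displays agrees. [cite: Balaban1985BackgroundPropagators, (3.15) p.393] -/
theorem QkOfU_display_irrel : QkOfU L m hL (n + 1) U αU hα1 hU1 hreg = QkOfU L m hL (n + 1) U αU' hα1' hU1' hreg' :=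
  Qtower_display_irrel L m hL (UlevOf L m (n + 1) U) αU αU' hα1 hα1' hU1 hU1' hreg hreg' (n + 1)

/-- **`Q_{n+1}(U)` ON THE WEIGHTED `L²` SPACES AT TWO REGULARITY DISPLAYS IS THE SAME MAP.** [cite: Balaban1985BackgroundPropagators, (3.15)–(3.16) p.393] -/
theorem QkW_display_irrel :
    QkW L m n φ U hL αU hα1 hU1 hreg (c₀ := c₀) (c₁ := c₁) = QkW L m n φ U hL αU' hα1' hU1' hreg' (c₀ := c₀) (c₁ := c₁) := by
  unfold QkW
  rw [QkOfU_display_irrel L m n U hL αU αU' hα1 hα1' hU1 hU1' hreg hreg']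

variable [FiniteDimensional ℂ W] [Fact (0 < c₀)] [StarRing 𝔸] [StarModule ℂ 𝔸] [Fact (0 < c₁)] (τ : 𝔸 →ₗ[ℂ] ℂ) (a : ℝ)

/-- **`Δ_{a,k}(U)` OF (3.26) AT TWO REGULARITY DISPLAYS IS THE SAME MAP.** [cite: Balaban1985BackgroundPropagators, (3.26) p.395] -/
theorem laplaceAk_display_irrel :
    laplaceAk L m n φ η U hL αU hα1 hU1 hreg τ (c₀ := c₀) (c₁ := c₁) a = laplaceAk L m n φ η U hL αU' hα1' hU1' hreg' τ (c₀ := c₀) (c₁ := c₁) a := by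
  unfold laplaceAk
  rw [QkW_display_irrel L m n φ U hL αU αU' hα1 hα1' hU1 hU1' hreg hreg']

variable {a}
  (hαL : ∀ j, 50 * (d + 1) * αU j * (L : ℝ) ^ d ≤ 1 / 2) (hαL' : ∀ j, 50 * (d + 1) * αU' j * (L : ℝ) ^ d ≤ 1 / 2)
  (hpos : ∀ x : BondL2K ℂ d (towerP L m (n + 1)) c₀ W, x ≠ 0 →
    0 < RCLike.re ⟪x, laplaceAk L m n φ η U hL αU hα1 hU1 hreg τ (c₀ := c₀) (c₁ := c₁) a x⟫_ℂ)
  (hpos' : ∀ x : BondL2K ℂ d (towerP L m (n + 1)) c₀ W, x ≠ 0 →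
    0 < RCLike.re ⟪x, laplaceAk L m n φ η U hL αU' hα1' hU1' hreg' τ (c₀ := c₀) (c₁ := c₁) a x⟫_ℂ)

include hα1' hU1' hreg' hpos' in
/-- **`G₁,k(U) = Δ_{a,k}(U)⁻¹` AT TWO DISPLAYS AND TWO POSITIVITY WITNESSES IS THE SAME MAP.** [cite: Balaban1985Variational, (110) p.294; Balaban1985BackgroundPropagators, Thm 3.11 p.416] -/
theorem G1k_display_irrel :
    G1k L m n φ η U hL αU hα1 hU1 hreg τ (c₀ := c₀) (c₁ := c₁) (a := a) hpos =
      G1k L m n φ η U hL αU' hα1' hU1' hreg' τ (c₀ := c₀) (c₁ := c₁) (a := a) hpos' := by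
  unfold G1k
  exact G1LatticeK_congr (QkW_display_irrel L m n φ U hL αU αU' hα1 hα1' hU1 hU1' hreg hreg') hpos hpos'

include hα1' hU1' hreg' hpos' in
/-- **`(Q_kG₁,kQ_k†)⁻¹` AT TWO DISPLAYS, TWO ONTO-THRESHOLDS AND TWO POSITIVITY WITNESSES IS THE SAME MAP.** [cite: Balaban1985Variational, (45) p.285] -/
theorem KinvLatticeK_display_irrel :
    KinvLatticeK hpos (B9Eq326OperatorTower.QkW_surjective L m n φ U hL αU hα1 hU1 hreg (c₀ := c₀) (c₁ := c₁) hαL) =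
      KinvLatticeK hpos' (B9Eq326OperatorTower.QkW_surjective L m n φ U hL αU' hα1' hU1' hreg' (c₀ := c₀) (c₁ := c₁) hαL') :=
  KinvLatticeK_congr (QkW_display_irrel L m n φ U hL αU αU' hα1 hα1' hU1 hU1' hreg hreg') hpos hpos' _ _

include hα1' hU1' hreg' hpos' in
/-- **`H₁,k(U) = G₁,kQ_k†(Q_kG₁,kQ_k†)⁻¹` OF (3.126) AT TWO REGULARITY DISPLAYS, TWO ONTO-THRESHOLDS AND TWO POSITIVITY WITNESSES IS THE SAME MAP** — the
`∃ αU hα1 hαL hU1 hreg hpos` packaging of «Y12a»∕«Y12b» loses nothing. [cite: Balaban1985BackgroundPropagators, (3.126) p.420; Balaban1985Variational, (45) p.285, (103) p.293] -/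
theorem H1k_display_irrel :
    H1k L m n φ η U hL αU hα1 hU1 hreg τ (c₀ := c₀) (c₁ := c₁) (a := a) hαL hpos =
      H1k L m n φ η U hL αU' hα1' hU1' hreg' τ (c₀ := c₀) (c₁ := c₁) (a := a) hαL' hpos' := by
  unfold H1k
  exact H1LatticeK_congr (QkW_display_irrel L m n φ U hL αU αU' hα1 hα1' hU1 hU1' hreg hreg') hpos hpos' _ _

end Tower

end Literature.MathematicalPhysics.QuantumFieldTheory.Balaban1983to89.Beta.RemainderTowerDisplayIrrel

end
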